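import Literature.Analysis.FluidPDE.Tao2016AveragedNS.SplitCascadeRescaledStepAssembly
import Literature.Analysis.FluidPDE.Tao2016AveragedNS.SplitCascadeLocalBlowup
import HarnessLib

/-!
# The split cascade blows up: Theorem 4.2♯ and Theorem 3.3♯ (PROVED, model statements)

T. Tao, *Finite time blowup for an averaged three-dimensional Navier–Stokes equation*, J. Amer. Math.
Soc. **29** (2016), 601–674 = arXiv:1402.0290v3: §4 Lemma 4.1, Theorem 4.2 ("Theorem 3.3 now
follows from the following ODE result"), §3 Theorem 3.3, §6.1 p. 31 ("To prove Theorem 4.2, it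
thus suffices to show Theorem 6.2").
HONEST FRAMING (cell harvest/h2-tao-ladder, rung 1 of a ladder of MODEL equations): statements about
Tao's class of LOCAL CASCADE EQUATIONS `∂ₜu = Δu + C(u,u)` (Definition 3.1) with the cell's SPLIT
(square-free) coefficient table; nothing here concerns the true Navier–Stokes equations, and nothing
here says that the split operator is a dilation-free averaged Euler operator (the cell's R1-a).

The split Theorem 6.2♯ `noGlobalSplit_holds` (`SplitCascadeRescaledStepAssembly.lean`) is exactly the
hypothesis `h62` of the tree's PROVED reductions `splitOdeBlowup_of_noGlobalSplit`
(`SplitCascadeReduction.lean`) and `splitLocalCascade_blowup_of_noGlobalSplit`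
(`SplitCascadeLocalBlowup.lean`); discharging it gives, unconditionally:

* `splitOdeBlowup_holds` — **Theorem 4.2♯**: for every `0 < ε₀ < 1` there are `K, ε > 0` such that
  the split table `splitCoeff ε₀ K ε` (symmetric, cancelling, SQUARE-FREE, seven modes per scale)
  with the two-wavelet datum `splitDatum = (1/√2)(1_{a′} + 1_{a″})` admits, for all implied constants
  `K₁, K₂ ≥ 0` and all large `n₀`, no global family obeying the conclusions of Lemma 4.1;
* `splitODEBlowup_stub` — the same in the shape of the cell's registered stub `stub_splitODEBlowup`
  (crux `SplitCascadeBlowup`, item stmt-NavierStokesRegularity-19872), in the TREE's vocabulary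
  (`TaoCascade.CascadeODESolutionFrom ε₀ α K₁ K₂ n₀ X₀ X E`, `TaoCascade.IsSquareFreeCoeff`; the
  skeleton's local copies have the datum argument in a different position and the name
  `IsInputSquareFree` for the same predicate);
* `splitLocalCascade_blowup` — **Theorem 3.3♯**: for every `0 < ε₀ < 1` there are `K, ε > 0` such
  that for EVERY seven-profile wavelet data `𝒟` the split cascade operator is a symmetric local
  cascade form with cancellation whose initial-value problem from the Schwartz divergence-free
  two-wavelet datum has no global mild `H¹⁰_df` solution for all large `n₀`.

(Tao's Theorem 3.3 as printed, `Tao2016.localCascade_blowup`, is already the tree theorem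
`Tao2016.localCascade_blowup_holds`; `localCascade_blowup_of_noGlobalSplit noGlobalSplit_holds` is a
second proof of it with the square-free witness and is not restated here.)
Theorems only; all by one-line application of the tree's reductions to `noGlobalSplit_holds`.

## References

* T. Tao, J. Amer. Math. Soc. 29 (2016), 601–674 = arXiv:1402.0290v3, Thm. 3.3, Lemma 4.1,
  Thm. 4.2, §6.1 p. 31, Thm. 6.2. [`Tao2016AveragedNS`]
-/

noncomputable section

open Set MeasureTheory

namespace Literature.Analysis.FluidPDE

namespace Tao2016AveragedNS

open TaoCascade (IsSymmetricCoeff IsCancellingCoeff IsSquareFreeCoeff CascadeODESolutionFrom)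
open Tao2016

/-- **Theorem 4.2♯ (PROVED; model statement).** For every `0 < ε₀ < 1` there are `K > 0`, `ε > 0`
such that the split table `splitCoeff ε₀ K ε` is symmetric, cancelling and square-free and, for all
implied constants `K₁, K₂ ≥ 0` and all sufficiently large `n₀`, there is NO global family
`X_{i,n}, E_{i,n}` obeying the conclusions (4.5)–(4.11) of Lemma 4.1 with the two-wavelet datum
`splitDatum` on the shell `n₀`. [cite: Tao2016AveragedNS, Thm. 4.2; §6.1 p. 31] -/
theorem splitOdeBlowup_holds :
    ∀ ε₀ : ℝ, 0 < ε₀ → ε₀ < 1 →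
      ∃ K ε : ℝ, 0 < K ∧ 0 < ε ∧
        IsSymmetricCoeff (splitCoeff ε₀ K ε) ∧ IsCancellingCoeff (splitCoeff ε₀ K ε) ∧
        IsSquareFreeCoeff (splitCoeff ε₀ K ε) ∧
        ∀ K₁ K₂ : ℝ, 0 ≤ K₁ → 0 ≤ K₂ → ∃ N₀ : ℤ, ∀ n₀ : ℤ, N₀ ≤ n₀ →
          ¬ ∃ X E : Fin 7 → ℤ → ℝ → ℝ,
            CascadeODESolutionFrom ε₀ (splitCoeff ε₀ K ε) K₁ K₂ n₀ splitDatum X E :=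
  splitOdeBlowup_of_noGlobalSplit noGlobalSplit_holds

/-- **Theorem 4.2♯ in the shape of the registered stub `stub_splitODEBlowup`** (crux
`SplitCascadeBlowup` of route TaoLadderRungOne), in the tree's vocabulary: with `ε₂ = ½` and `m = 7`,
for every `0 < ε₀ ≤ ε₂` a symmetric, cancelling, square-free table on `m ≤ 9` modes and a datum
vector such that for all `K₁, K₂ ≥ 0` and all large `n₀` the generalised-datum cascade conclusions
have no global solution. [cite: Tao2016AveragedNS, Thm. 4.2, Thm. 6.2] -/
theorem splitODEBlowup_stub :
    ∃ ε₂ : ℝ, 0 < ε₂ ∧ ∀ ε₀ : ℝ, 0 < ε₀ → ε₀ ≤ ε₂ → ∃ m : ℕ, m ≤ 9 ∧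
      ∃ (α : Fin m → Fin m → Fin m → ℤ × ℤ × ℤ → ℝ) (a : Fin m → ℝ),
        IsSymmetricCoeff α ∧ IsCancellingCoeff α ∧ IsSquareFreeCoeff α ∧
          ∀ K₁ K₂ : ℝ, 0 ≤ K₁ → 0 ≤ K₂ → ∃ N₀ : ℤ, ∀ n₀ : ℤ, N₀ ≤ n₀ →
            ¬ ∃ X E : Fin m → ℤ → ℝ → ℝ, CascadeODESolutionFrom ε₀ α K₁ K₂ n₀ a X E := by
  refine ⟨1 / 2, by norm_num, fun ε₀ hε₀ hε₀le => ?_⟩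
  obtain ⟨K, ε, -, -, hsymm, hcanc, hsq, hno⟩ :=
    splitOdeBlowup_holds ε₀ hε₀ (hε₀le.trans_lt (by norm_num))
  exact ⟨7, by norm_num, splitCoeff ε₀ K ε, splitDatum, hsymm, hcanc, hsq, hno⟩

/-- **Theorem 3.3♯ (PROVED; model statement): the split local cascade equation blows up.** For
every `0 < ε₀ < 1` there are `K > 0`, `ε > 0` (with `splitCoeff ε₀ K ε` square-free) such that for
EVERY wavelet data `𝒟` with seven profiles the split cascade operator `C♯ = cascadeOperatorForm ε₀ 𝒟.ψ
(splitCoeff ε₀ K ε)` is a local cascade form (Definition 3.1), symmetric, with the cancellation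
property, and for all sufficiently large `n₀` the Schwartz divergence-free two-wavelet datum
`(ψ_{0,n₀} + ψ_{1,n₀})/√2` admits NO global mild `H¹⁰_df` solution of `∂ₜu = Δu + C♯(u,u)`.
[cite: Tao2016AveragedNS, Thm. 3.3; §4 pp. 21–23] -/
theorem splitLocalCascade_blowup {ε₀ : ℝ} (hε₀ : 0 < ε₀) (hε₀1 : ε₀ < 1) :
    ∃ K ε : ℝ, 0 < K ∧ 0 < ε ∧
      IsSquareFreeCoeff (splitCoeff ε₀ K ε) ∧
      ∀ 𝒟 : CascadeWaveletData ε₀ 7,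
        IsLocalCascadeForm ε₀ (cascadeOperatorForm ε₀ 𝒟.ψ (splitCoeff ε₀ K ε)) ∧
        (∀ u v w, cascadeOperatorForm ε₀ 𝒟.ψ (splitCoeff ε₀ K ε) u v w =
          cascadeOperatorForm ε₀ 𝒟.ψ (splitCoeff ε₀ K ε) v u w) ∧
        (∀ u, cascadeOperatorForm ε₀ 𝒟.ψ (splitCoeff ε₀ K ε) u u u = 0) ∧
        ∃ N₀ : ℤ, ∀ n₀ : ℤ, N₀ ≤ n₀ →
          VectorCalculus.IsDivFree ⇑(splitSchwartzDatum hε₀ 𝒟 n₀) ∧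
          ¬ ∃ u : ℝ → L2C,
            IsMildSolutionFor (cascadeOperatorForm ε₀ 𝒟.ψ (splitCoeff ε₀ K ε))
              (schwartzL2 (splitSchwartzDatum hε₀ 𝒟 n₀)) (Ici 0) u :=
  splitLocalCascade_blowup_of_noGlobalSplit noGlobalSplit_holds hε₀ hε₀1

end Tao2016AveragedNS

end Literature.Analysis.FluidPDE
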